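import Literature.Computability.Complexity.Counting
import Literature.Computability.Cryptography.Postselection
import HarnessLib

/-!
# Approximate counting with an `NP` oracle (Stockmeyer) and `PostBPP ⊆ BPP^{NP}`

Two classical facts about approximate counting, vendored as named facts (statements; no proof
in the tree yet) because they are ingredients of the sampling-hardness arguments of the
`quantum-advantage` family — in particular of Aaronson–Arkhipov's Main Theorem (AA13 Thm. 1.3,
the named fact `Literature.Computability.QuantumComplexity.gpeSolvableInFBPPRel_NP_of_uniformApproxBosonSampling` of
`Literature/Computability/QuantumComplexity/BosonSamplingHardness.lean`), whose proof (§5.2)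
uses both: Stockmeyer counting at eq. (5.89) and `PostBPP ⊆ BPP^{NP}` inside the Hiding
Lemma 5.8 (p. 192).

Sources.

* L. J. Stockmeyer, *On approximation algorithms for #P*, SIAM J. Comput. 14 (1985) 849–861
  (`Stockmeyer1985`), in the form restated by S. Aaronson and A. Arkhipov, *The computational
  complexity of linear optics*, Theory of Computing 9 (2013) 143–252 (AA13, journal
  pagination), Thm. 4.1, p. 175: "Given a Boolean function `f : {0,1}ⁿ → {0,1}` let
  `p = Pr_{x ∈ {0,1}ⁿ}[f(x) = 1] = 2⁻ⁿ ∑_x f(x)`. Then for all `g ≥ 1 + 1/poly(n)` there exists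
  an `FBPP^{NP^f}` machine that approximates `p` to within a multiplicative factor of `g`."
  AA13 add: "Intuitively, Theorem 4.1 says that a `BPP^{NP}` machine can always estimate the
  probability `p` that a polynomial-time randomized algorithm accepts to within a `1/poly(n)`
  multiplicative factor, even if `p` is exponentially small." Here `FBPP` is AA13 Def. 2.4
  (p. 163): given `⟨x, 0^{1/ε}⟩`, the machine "produces an output `y` such that
  `Pr[y ∈ B_x] ≥ 1 − ε`, where the probability is over `A`'s internal randomness", in time
  polynomial in `|x|` and `1/ε`.
* AA13 §2, eq. (2.1), p. 162: "`PostBPP` is easily seen to equal a complexity class called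
  `BPP_path` which was defined by Han, Hemaspaandra, and Thierauf. In particular, it follows
  from Han et al.'s results that `MA ⊆ PostBPP ⊆ BPP^{NP}`." (Y. Han, L. Hemaspaandra,
  T. Thierauf, *Threshold computation and cryptographic security*, SIAM J. Comput. 26 (1997)
  59–78; the same inclusion is quoted in G. Kuperberg, *How hard is it to approximate the Jones
  polynomial?*, arXiv:0908.0512 (2009), p. 4, item 4: "Without any derandomization assumption,
  `PostBPP ⊆ BPP^{NP} ⊆ NP^{NP^{NP}}`".)

## Tree form

* **The form of Thm. 4.1 that is used.** AA13 apply Thm. 4.1 (pp. 193–194, eqs. (5.80) and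
  (5.89)) to `q_{S*} = Pr_r[O(A, 0^{1/β}, r) = S*]`, i.e. to the Boolean function
  `r ↦ [⟨y, r⟩ ∈ R]` of a relation `R ∈ P^O` at an instance `y = ⟨A, 0^{1/β}, S*⟩` which is an
  *input* of the counting machine, "in `FBPP^{NP^O}`", "in time polynomial in `m` and `1/α`".
  `stockmeyerApproxCounting` is exactly this uniform, relativised, input-indexed form: for every
  oracle `O` and every `R ∈ P^O` (`PRel O`) there are a language `L ∈ NP^O` (`NPRel O`), a
  deterministic polynomial-time oracle transducer `F` with oracle `L`
  (`F ∈ FPRel (Oracle.ofLanguage L)`) reading its coins `u` from the query — AA13's convention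
  for randomised machines, Thm. 1.1 (p. 149): "a deterministic algorithm that takes a random
  string `r` as part of its input" — and a polynomial coin budget `c`, such that on
  `⟨x, 1^m, 1^{kη}, 1^{kδ}, u⟩` (`countQuery`) the answer read as a natural number `N`
  (`countEstimate`) satisfies `#/(1 + η) ≤ N ≤ (1 + η) · #` (`IsApproxCount`) for
  `# = #{y ∈ {0,1}^m | ⟨x, y⟩ ∈ R}` (`countWitnesses R m x`, `Counting.lean`) and `η = 1/kη`,
  except for a fraction `≤ 1/kδ` of the coin strings `u ∈ {0,1}^{c(|x| + m + kη + kδ)}`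
  (`uniformProb`, Def. 2.4 with `ε = 1/kδ`). Counts replace probabilities (`p = #/2^m`, same
  factor); integer estimates lose nothing (`#` itself qualifies, `isApproxCount_self`); the
  accuracy and confidence parameters are unary (the `0^{1/ε}` convention of Def. 2.4).
* The transducer's only oracle is the single language `L ∈ NP^O`, as for an `FBPP^{NP^f}`
  machine, which reaches `f` only through its oracle (several `NP^O` languages merge into one
  by a tagged union).
* `PostBPP ⊆ BPP^{NP}` is stated with the tree's `PostBPP` (`Postselection.lean`; `= BPP_path`)
  and `BPPRelClass NP = ⋃_{L ∈ NP} BPP^L` (`Oracle.lean`). The tree also holds the upper bound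
  `PostBPP ⊆ Δ₃ᵖ` (`PostBPP_subset_DeltaP_three`, HHT 1997 Thm. 3.11 (1)), a different
  statement; AA13's Lemma 5.8 uses the `BPP^{NP}` bound.

What a discharge would need. For Thm. 4.1: pairwise-independent hashing (Sipser–Stockmeyer),
the `NP^O` language "at least one `t`-tuple of `R`-witnesses hashes to `0`", and an oracle
transducer doing the search over hash ranges and the `t`-fold product for factors `1 + 1/kη`,
in the transcript model of `Oracle.lean`. For `PostBPP ⊆ BPP^{NP}`: Thm. 4.1 for the two `P`
predicates of a `PostBPP` machine (empty oracle) and the closure of `BPP^L` under `FP^L`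
subroutines (cf. `Literature.Computability.QuantumComplexity.PRel_subset_PRel_of_mem_FPRel`).
-/

namespace Literature.Computability.Complexity

open _root_.Computability

/-! ### Queries and answers of an approximate counter -/

/-- The query `⟨x, 1^m, 1^{kη}, 1^{kδ}, u⟩` to an approximate counter: the instance `x`, the
witness length `m`, the accuracy `η = 1/kη` and the confidence `δ = 1/kδ` in unary
(`Computability.unaryEncodeNat`; AA13 Def. 2.4: "given `⟨x, 0^{1/ε}⟩` as input"), and the coin
string `u`, assembled with `boolPair`. [cite: AaronsonArkhipovToC2013, Def. 2.4 (p. 163) with Thm. 1.1 (p. 149)] -/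
def countQuery (x : List Bool) (m kη kδ : ℕ) (u : List Bool) : List Bool :=
  boolPair (boolPair x (boolPair (unaryEncodeNat m)
    (boolPair (unaryEncodeNat kη) (unaryEncodeNat kδ)))) u

/-- The estimate returned by the transducer `F` on the query `⟨x, 1^m, 1^{kη}, 1^{kδ}, u⟩`, read
as a natural number in binary (`Computability.decodeNat`; a malformed answer decodes to some
number, harmless for an upper bound on the failure probability). [folklore] -/
def countEstimate (F : List Bool → List Bool) (x : List Bool) (m kη kδ : ℕ) (u : List Bool) :
    ℕ :=
  decodeNat (F (countQuery x m kη kδ u))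

/-- `IsApproxCount kη n N`: the number `N` approximates `n` to within the multiplicative factor
`g = 1 + 1/kη`, i.e. `n / g ≤ N ≤ g · n` (AA13 Thm. 4.1: "approximates `p` to within a
multiplicative factor of `g`", "for all `g ≥ 1 + 1/poly(n)`"). [cite: AaronsonArkhipovToC2013, Thm. 4.1 (p. 175)] -/
def IsApproxCount (kη n N : ℕ) : Prop :=
  (n : ℝ) / (1 + 1 / (kη : ℝ)) ≤ N ∧ (N : ℝ) ≤ (1 + 1 / (kη : ℝ)) * n

/-- The exact count is an approximate count at every accuracy (so the success criterion is
satisfiable, by `N = n`). [folklore] -/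
theorem isApproxCount_self (kη n : ℕ) : IsApproxCount kη n n := by
  have h0 : (0 : ℝ) ≤ 1 / (kη : ℝ) := by positivity
  have hg : (1 : ℝ) ≤ 1 + 1 / (kη : ℝ) := by linarith
  have hn : (0 : ℝ) ≤ n := by positivity
  refine ⟨?_, ?_⟩
  · rw [div_le_iff₀ (by positivity)]
    simpa using mul_le_mul_of_nonneg_left hg hn
  · simpa using mul_le_mul_of_nonneg_right hg hn

/-- Unfolding lemma for `countEstimate`. [folklore] -/
theorem countEstimate_def (F : List Bool → List Bool) (x : List Bool) (m kη kδ : ℕ)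
    (u : List Bool) :
    countEstimate F x m kη kδ u = decodeNat (F (countQuery x m kη kδ u)) :=
  rfl

/-! ### The named facts -/

/-- **Stockmeyer's approximate counting theorem, relativised** (AA13 Thm. 4.1, after Stockmeyer
1985), in the uniform input-indexed form in which AA13 use it (pp. 193–194, eqs. (5.80), (5.89)):
for every oracle `O` and every relation `R ∈ P^O` there exist a language `L ∈ NP^O`, a
polynomial-time oracle transducer `F ∈ FP^L` and a polynomial coin budget `c` such that for all
instances `x`, witness lengths `m` and all `kη, kδ ≥ 1`, for all but a fraction `≤ 1/kδ` of the
coin strings `u ∈ {0,1}^{c(|x| + m + kη + kδ)}` the answer of `F` on `⟨x, 1^m, 1^{kη}, 1^{kδ}, u⟩`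
is a number `N` with `#/(1 + 1/kη) ≤ N ≤ (1 + 1/kη) · #`, where `# = #{y ∈ {0,1}^m | ⟨x, y⟩ ∈ R}`:
the counting function of `R` is approximable to within every factor `1 + 1/poly` in
`FBPP^{NP^O}` ("for all `g ≥ 1 + 1/poly(n)` there exists an `FBPP^{NP^f}` machine that
approximates `p = Pr_x[f(x) = 1]` to within a multiplicative factor of `g`"; here
`f = [⟨x, ·⟩ ∈ R] ∈ P^O` and `NP^f ⊆ NP^O`). See the module docstring for the reading. Not in
Mathlib; stated as a `Prop`.
[cite: AaronsonArkhipovToC2013, Thm. 4.1 (p. 175) with Def. 2.4 (p. 163) and eqs. (5.80), (5.89) (pp. 193–194)] -/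
def stockmeyerApproxCounting : Prop :=
  ∀ (O : Oracle) (R : Language Bool), R ∈ PRel O →
    ∃ L ∈ NPRel O, ∃ F ∈ FPRel (Oracle.ofLanguage L), ∃ c : Polynomial ℕ,
      ∀ (x : List Bool) (m kη kδ : ℕ), 0 < kη → 0 < kδ →
        uniformProb (c.eval (x.length + m + kη + kδ))
            {u | ¬ IsApproxCount kη (countWitnesses R m x) (countEstimate F x m kη kδ u)} ≤
          1 / (kδ : ℝ)

/-- **`PostBPP ⊆ BPP^{NP}`** (AA13 §2, eq. (2.1): "it follows from Han et al.'s results that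
`MA ⊆ PostBPP ⊆ BPP^{NP}`" — Han–Hemaspaandra–Thierauf 1997, with `BPP_path = PostBPP`; quoted
likewise by Kuperberg 2009, p. 4): classical polynomial time with postselection is simulable with
bounded error given an `NP` oracle (by approximate counting, Thm. 4.1, of the postselection and
acceptance events). With the tree's classes `PostBPP` (`Postselection.lean`) and
`BPPRelClass NP = ⋃_{L ∈ NP} BPP^L`. Stated as a `Prop`.
[cite: AaronsonArkhipovToC2013, §2 eq. (2.1) (p. 162)] -/
def PostBPP_subset_BPPRelClass_NP : Prop :=
  Literature.Computability.Cryptography.PostBPP ⊆ BPPRelClass Nondeterministic.NP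

end Literature.Computability.Complexity
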